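/-
Copyright (c) 2026 the pub-hodgecm-mathlib formalisation cell (harness21).  Prover seat hodgecm-mathlib-K2E3-p06 (g6) (E3 hand lent to L1; LEAD F0P6-plan (g14) BATCH #106 (1);
desk K2E3-p14 (g9)), Track B «K2-LIT» ∕ hLiu418 = stmt-HodgeConjecture-24832: U1-CT-ind stage 3, brick B2a′, file W-FE-1a — Haar translation of a twisted ball integral and the
vanishing of far-ball twisted integrals of a rank-one tail.  THEOREMS ONLY (no `def`∕`instance`∕notation∕`sorry`).
-/
import Summits.HodgeConjecture.HodgeConjecture.Theorems.K2LiuRankOneStageTwisted   -- ★ (K1a-3)-S (K2E3-p29 (g2)): the twisted-stage currency `conj ψ(σx)`; brings ★ Tate `primePowBall`, `AddChar.HasConductorExp`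
import HarnessLib

/-!
# Crux `HLiu418`, organ U1-CT-ind STAGE 3 («U1-glob»), brick B2a′, file W-FE-1a: HAAR TRANSLATION OF A TWISTED BALL INTEGRAL AND THE FAR BALL —
# `∫_{𝔭^N} conj ψ(σx) Φ(x + c) dμ = ψ(σc)·∫_{c+𝔭^N} conj ψ(σx) Φ(x) dμ`, and `∫_{c+𝔭^{−M}} conj ψ(σ·)·g = 0` for a far centre `c ∉ 𝔭^{−M}` and a tail `g = C ν(·)⁻¹‖·‖^{−e}`
# [Tate1950 §2.5; CasselmanShalika1980 §2]

Cell `hodgecm-mathlib`, crux item hLiu418 = `stmt-HodgeConjecture-24832`; squad K2, strike line L1, LEAD F0P6-plan (g14); desk K2E3-p14 (g9) + K2Liu-p13 (g4);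
prover K2E3-p06 (g6).  Lane `--supports stmt-HodgeConjecture-24832 --as helper` (count-neutral).  Any non-archimedean local field `F`, additive Haar `μ`, `ψ : AddChar F Circle`
(★ Tate currency, conductor exponent `c_ψ`), and ★ B5b's tail letters `(ν, C, e, htail)` with a CONDUCTOR LETTER `hνc` for `ν` (trivial on the units `≡ 1 (mod 𝔭^{c_ν})`;
`c_ν ≤ 1` for unramified `ν`).  These are the two measure-theoretic inputs of the rank-one ψ-Whittaker functional equation (sequel W-FE-1 `K2LiuRankOneWhittakerFunctionalEquation`):
* §1 **`setIntegral_primePowBall_twisted_comp_add`** — the substitution `x ↦ x − c` in a twisted ball integral (no integrability needed); the shifted ball `c + 𝔭^N` is `𝔭^N`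
  iff `c ∈ 𝔭^N` (`setOf_sub_mem_primePowBall_eq_of_mem`, `not_mem_primePowBall_of_sub_mem`).
* §2 THE FAR BALL: `setIntegral_twisted_eq_zero_of_invariant` (Tate's translation trick on ANY invariant measurable set against `conj ψ(σ·)` — ★ (K1a-3)-S
  `setIntegral_compl_twisted_eq_zero` is the case of a complement `𝕜 ∖ 𝔭^n` with `t₀ ∈ 𝔭^n`), `apply_add_eq_of_tail` (the tail does not move under `t₀ ∈ 𝔭^j` off `𝔭^{−M}`
  when `M ≥ max(−n, −j, c_ν − j − 1)`), **`setIntegral_farBall_twisted_eq_zero`** (`c ∉ 𝔭^{−M}`, `σ ∉ 𝔭^{c_ψ − j}` ⟹ `∫_{c+𝔭^{−M}} conj ψ(σx)·g(x) dμ = 0`, at EVERY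
  exponent `e`, no integrability).
References: [Tate1950] J. Tate, *Fourier analysis in number fields and Hecke's zeta-functions* (1950), §2.2, §2.5; [CasselmanShalika1980] W. Casselman, J. Shalika, Compositio
Math. 41 (1980), §2 (far shells of the Whittaker functional); [BushnellHenniart2006] C. J. Bushnell, G. Henniart (2006), §1.1.
HONEST LABEL.  Count-neutral helper: `HC_CM` is proved only modulo the 7 printed citations (2 remaining named inputs: hLiu418 = `stmt-HodgeConjecture-24832`,
h413 = `stmt-HodgeConjecture-24833`) until rung 0 closes; closes no socket.
-/

set_option autoImplicit false
set_option linter.dupNamespace false -- the mandated namespace repeats `HodgeConjecture.HodgeConjecture`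

noncomputable section

open MeasureTheory Filter Topology Set
open scoped NNReal ENNReal ComplexConjugate
open Literature.NumberTheory.GaloisRepresentations.IsNonarchimedeanLocalField
open Literature.NumberTheory.Automorphic Literature.NumberTheory.Automorphic.LocalFieldHaar

namespace Summit.HodgeConjecture.HodgeConjecture.Cruxes.HLiu418.K2LiuTwistedFarBall

/-! ## §1 Haar translation of a twisted ball integral -/

section Translation

variable {F : Type*} [Field F] [ValuativeRel F] [TopologicalSpace F] [IsNonarchimedeanLocalField F]

/-- for `c ∈ 𝔭^N` the shifted ball `c + 𝔭^N` is `𝔭^N`. [cite: Tate1950, §2.2] -/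
theorem setOf_sub_mem_primePowBall_eq_of_mem {N : ℤ} {c : F} (hc : c ∈ primePowBall F N) :
    {x : F | x - c ∈ primePowBall F N} = primePowBall F N := by
  ext x
  simp only [Set.mem_setOf_eq]
  constructor
  · intro h
    have h' := add_mem_primePowBall h hc
    rwa [sub_add_cancel] at h'
  · intro h
    rw [sub_eq_add_neg]
    exact add_mem_primePowBall h (neg_mem_primePowBall hc)

/-- for `c ∉ 𝔭^N` the shifted ball `c + 𝔭^N` misses `𝔭^N`. [cite: Tate1950, §2.2] -/
theorem not_mem_primePowBall_of_sub_mem {N : ℤ} {c : F} (hc : c ∉ primePowBall F N) {x : F} (hx : x - c ∈ primePowBall F N) :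
    x ∉ primePowBall F N := fun h => hc (by
  have h' := add_mem_primePowBall h (neg_mem_primePowBall hx)
  rwa [neg_sub, add_sub_cancel] at h')

omit [ValuativeRel F] [TopologicalSpace F] [IsNonarchimedeanLocalField F] in
/-- on the circle `ψ(z) · conj ψ(z) = 1`. [folklore] -/
theorem addChar_mul_conj (ψ : AddChar F Circle) (z : F) : ((ψ z : ℂ)) * conj ((ψ z : ℂ)) = 1 := by
  rw [← Circle.coe_inv_eq_conj, ← Circle.coe_mul, mul_inv_cancel, Circle.coe_one]

variable [MeasurableSpace F] [BorelSpace F] (μ : Measure F) [μ.IsAddHaarMeasure]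

/-- **HAAR TRANSLATION OF A TWISTED BALL INTEGRAL**: `∫_{𝔭^N} conj ψ(σx) · Φ(x + c) dμ = ψ(σc) · ∫_{c + 𝔭^N} conj ψ(σx) · Φ(x) dμ` (the substitution `x ↦ x − c` in an
additive Haar integral; no integrability needed). [cite: Tate1950, §2.5] -/
theorem setIntegral_primePowBall_twisted_comp_add (ψ : AddChar F Circle) (σ : F) (Φ : F → ℂ) (N : ℤ) (c : F) :
    ∫ x in primePowBall F N, conj ((ψ (σ * x) : ℂ)) * Φ (x + c) ∂μ =
      ((ψ (σ * c) : ℂ)) * ∫ x in {x : F | x - c ∈ primePowBall F N}, conj ((ψ (σ * x) : ℂ)) * Φ x ∂μ := by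
  have hT : MeasurableSet {x : F | x - c ∈ primePowBall F N} := (measurableSet_primePowBall N).preimage (measurable_id.sub_const c)
  -- `G(x) := 1_{c+𝔭^N}(x) conj ψ(σx) Φ(x)`; `∫ G(x + c) = ∫ G`
  have hshift : ∀ x, {x : F | x - c ∈ primePowBall F N}.indicator (fun x => conj ((ψ (σ * x) : ℂ)) * Φ x) (x + c) =
      conj ((ψ (σ * c) : ℂ)) * (primePowBall F N).indicator (fun x => conj ((ψ (σ * x) : ℂ)) * Φ (x + c)) x := by
    intro x
    by_cases hx : x ∈ primePowBall F N
    · have hx' : x + c ∈ {x : F | x - c ∈ primePowBall F N} := by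
        show x + c - c ∈ primePowBall F N
        rwa [add_sub_cancel_right]
      rw [Set.indicator_of_mem hx', Set.indicator_of_mem hx, mul_add σ, AddChar.map_add_eq_mul, Circle.coe_mul, map_mul]
      ring
    · have hx' : x + c ∉ {x : F | x - c ∈ primePowBall F N} := by
        show ¬ (x + c - c ∈ primePowBall F N)
        rwa [add_sub_cancel_right]
      rw [Set.indicator_of_notMem hx', Set.indicator_of_notMem hx, mul_zero]
  have key : ∫ x, conj ((ψ (σ * c) : ℂ)) * (primePowBall F N).indicator (fun x => conj ((ψ (σ * x) : ℂ)) * Φ (x + c)) x ∂μ =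
      ∫ x, {x : F | x - c ∈ primePowBall F N}.indicator (fun x => conj ((ψ (σ * x) : ℂ)) * Φ x) x ∂μ := by
    rw [← integral_add_right_eq_self ({x : F | x - c ∈ primePowBall F N}.indicator (fun x => conj ((ψ (σ * x) : ℂ)) * Φ x)) c]
    exact integral_congr_ae (Filter.Eventually.of_forall fun x => (hshift x).symm)
  rw [integral_const_mul, integral_indicator (measurableSet_primePowBall N), integral_indicator hT] at key
  -- multiply by `ψ(σc)` and use `ψ · conj ψ = 1`
  rw [← key, ← mul_assoc, addChar_mul_conj, one_mul]

end Translation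

/-! ## §2 The far ball: the tail does not move, its twisted integral vanishes -/

section FarBall

variable {F : Type*} [Field F] [ValuativeRel F] [TopologicalSpace F] [IsNonarchimedeanLocalField F]

/-- a small translation does not change the absolute value in the far region: `t₀ ∈ 𝔭^j`, `x ∉ 𝔭^{−M}`, `−M ≤ j` ⟹ `‖t₀ + x‖ = ‖x‖`. [cite: Tate1950, §2.2] -/
theorem normAbs_add_eq_of_tail {j M : ℤ} (hjM : -M ≤ j) {t₀ x : F} (ht₀ : t₀ ∈ primePowBall F j) (hx : x ∉ primePowBall F (-M)) :
    normAbs F (t₀ + x) = normAbs F x := by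
  rw [mem_primePowBall_iff] at ht₀ hx
  rw [add_comm]
  exact normAbs_add_eq_of_lt (lt_of_le_of_lt (le_trans ht₀ (inv_residueFieldCard_zpow_le_iff.2 hjM)) (not_le.1 hx))

/-- hence the far region `{x ∉ 𝔭^{−M}}` is invariant under small translations. [cite: Tate1950, §2.2] -/
theorem add_notMem_primePowBall_iff_of_tail {j M : ℤ} (hjM : -M ≤ j) {t₀ : F} (ht₀ : t₀ ∈ primePowBall F j) (x : F) :
    t₀ + x ∉ primePowBall F (-M) ↔ x ∉ primePowBall F (-M) := by
  constructor
  · exact fun hx' hx => hx' (add_mem_primePowBall (primePowBall_antitone hjM ht₀) hx)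
  · intro hx hx'
    rw [mem_primePowBall_iff] at hx hx'
    rw [normAbs_add_eq_of_tail hjM ht₀ (by rwa [mem_primePowBall_iff])] at hx'
    exact hx hx'

/-- **THE TAIL DOES NOT MOVE**: if `g = C ν(·)⁻¹ ‖·‖^{−e}` off `𝔭^n` (★ B5b's tail letters), `ν` is trivial on the units `≡ 1 (mod 𝔭^{c_ν})`, `t₀ ∈ 𝔭^j`, and
`M ≥ max(−n, −j, c_ν − j − 1)`, then `g(t₀ + x) = g(x)` for every `x ∉ 𝔭^{−M}` (`t₀ + x = x·(1 + t₀∕x)`, `1 + t₀∕x ≡ 1 (mod 𝔭^{c_ν})` a unit).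
[cite: Tate1950, §2.5] [cite: CasselmanShalika1980, §2] -/
theorem apply_add_eq_of_tail (g : F → ℂ) (ν : Fˣ →* ℂˣ) (cν : ℤ)
    (hνc : ∀ u : Fˣ, normAbs F (u : F) = 1 → (u : F) - 1 ∈ primePowBall F cν → ν u = 1) (C e : ℂ) {n : ℤ}
    (htail : ∀ u : Fˣ, (u : F) ∉ primePowBall F n → g u = C * (((ν u)⁻¹ : ℂˣ) : ℂ) * ((normAbs F (u : F) : ℝ) : ℂ) ^ (-e))
    {j M : ℤ} (hnM : -n ≤ M) (hjM : -M ≤ j) (hcM : cν - j - 1 ≤ M) {t₀ : F} (ht₀ : t₀ ∈ primePowBall F j)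
    {x : F} (hx : x ∉ primePowBall F (-M)) : g (t₀ + x) = g x := by
  have hx0 : x ≠ 0 := by
    rintro rfl
    exact hx (zero_mem_primePowBall _)
  have hnorm : normAbs F (t₀ + x) = normAbs F x := normAbs_add_eq_of_tail hjM ht₀ hx
  have hx'0 : t₀ + x ≠ 0 := fun h0 => by
    rw [h0, map_zero] at hnorm
    exact hx0 ((map_eq_zero (normAbs F)).1 hnorm.symm)
  have hxn : x ∉ primePowBall F n := fun h => hx (primePowBall_antitone (by omega) h)
  have hx'n : t₀ + x ∉ primePowBall F n := fun h =>
    ((add_notMem_primePowBall_iff_of_tail hjM ht₀ x).2 hx) (primePowBall_antitone (by omega) h)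
  set w₁ : F := 1 + t₀ * x⁻¹ with hw₁
  have hsmall : t₀ * x⁻¹ ∈ primePowBall F (j + M + 1) := by
    rw [mem_primePowBall_iff, map_mul, map_inv₀]
    rw [mem_primePowBall_iff] at ht₀ hx
    have hxq : (residueFieldCard F : ℝ≥0)⁻¹ ^ (-M - 1) ≤ normAbs F x := by
      obtain ⟨k, hk⟩ := exists_normAbs_eq_inv_zpow hx0
      rw [hk] at hx ⊢
      refine inv_residueFieldCard_zpow_le_iff.2 ?_
      have hlt : ¬ -M ≤ k := fun hle => hx (inv_residueFieldCard_zpow_le_iff.2 hle)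
      omega
    have hinv : (normAbs F x)⁻¹ ≤ ((residueFieldCard F : ℝ≥0)⁻¹ ^ (-M - 1))⁻¹ := inv_anti₀ (zpow_pos inv_residueFieldCard_pos _) hxq
    calc normAbs F t₀ * (normAbs F x)⁻¹
        ≤ (residueFieldCard F : ℝ≥0)⁻¹ ^ j * ((residueFieldCard F : ℝ≥0)⁻¹ ^ (-M - 1))⁻¹ := mul_le_mul' ht₀ hinv
      _ = (residueFieldCard F : ℝ≥0)⁻¹ ^ (j + M + 1) := by
          rw [← zpow_neg, ← zpow_add₀ inv_residueFieldCard_pos.ne']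
          congr 1
          ring
  have hsmall1 : t₀ * x⁻¹ ∈ primePowBall F 1 := primePowBall_antitone (by omega) hsmall
  have hw₁norm : normAbs F w₁ = 1 := by
    rw [hw₁]
    have hlt : normAbs F (t₀ * x⁻¹) < normAbs F 1 := by
      rw [map_one]
      rw [mem_primePowBall_iff, zpow_one] at hsmall1
      exact lt_of_le_of_lt hsmall1 inv_residueFieldCard_lt_one
    rw [normAbs_add_eq_of_lt hlt, map_one]
  have hw₁0 : w₁ ≠ 0 := fun h0 => by
    rw [h0, map_zero] at hw₁norm
    exact zero_ne_one hw₁norm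
  have hνw₁ : ν (Units.mk0 w₁ hw₁0) = 1 := by
    refine hνc _ (by rw [Units.val_mk0]; exact hw₁norm) ?_
    rw [Units.val_mk0, hw₁, add_sub_cancel_left]
    exact primePowBall_antitone (by omega) hsmall
  have hprod : t₀ + x = x * w₁ := by
    rw [hw₁, mul_add, mul_one, mul_comm t₀, ← mul_assoc, mul_inv_cancel₀ hx0, one_mul, add_comm]
  have hunits : Units.mk0 (t₀ + x) hx'0 = Units.mk0 x hx0 * Units.mk0 w₁ hw₁0 := by
    ext
    rw [Units.val_mk0, Units.val_mul, Units.val_mk0, Units.val_mk0, hprod]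
  have h1 := htail (Units.mk0 (t₀ + x) hx'0) (by rwa [Units.val_mk0])
  have h2 := htail (Units.mk0 x hx0) (by rwa [Units.val_mk0])
  rw [Units.val_mk0] at h1 h2
  rw [h1, h2, hnorm, hunits, map_mul, hνw₁, mul_one]

variable [MeasurableSpace F] [BorelSpace F] (μ : Measure F) [μ.IsAddHaarMeasure]

/-- **THE TRANSLATION TRICK against `conj ψ(σ·)`**: `S` measurable and invariant under `x ↦ t₀ + x`, `h(t₀ + x) = h(x)` on `S`, `ψ(σ t₀) ≠ 1` ⟹
`∫_S conj ψ(σx) · h(x) dμ = 0` (no integrability hypothesis). [cite: Tate1950, §2.5] -/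
theorem setIntegral_twisted_eq_zero_of_invariant (ψ : AddChar F Circle) (σ : F) {S : Set F} (hS : MeasurableSet S) (t₀ : F)
    (hSt : ∀ x, t₀ + x ∈ S ↔ x ∈ S) (h : F → ℂ) (hh : ∀ x ∈ S, h (t₀ + x) = h x) (hψ : ψ (σ * t₀) ≠ 1) :
    ∫ x in S, conj ((ψ (σ * x) : ℂ)) * h x ∂μ = 0 := by
  have hne : conj ((ψ (σ * t₀) : ℂ)) ≠ 1 := by
    intro h1
    apply hψ
    have h2 : ((ψ (σ * t₀) : ℂ)) = 1 := by
      have := congrArg conj h1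
      rwa [Complex.conj_conj, map_one] at this
    exact Circle.coe_eq_one.1 h2
  have key : ∫ x in S, conj ((ψ (σ * x) : ℂ)) * h x ∂μ =
      conj ((ψ (σ * t₀) : ℂ)) * ∫ x in S, conj ((ψ (σ * x) : ℂ)) * h x ∂μ := by
    rw [← integral_indicator hS, ← integral_const_mul, ← integral_add_left_eq_self _ t₀]
    refine integral_congr_ae (Filter.Eventually.of_forall fun x => ?_)
    beta_reduce
    by_cases hx : x ∈ S
    · have hx' : t₀ + x ∈ S := (hSt x).2 hx
      rw [Set.indicator_of_mem hx', Set.indicator_of_mem hx, hh x hx, mul_add σ, AddChar.map_add_eq_mul, Circle.coe_mul, map_mul]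
      ring
    · have hx' : t₀ + x ∉ S := fun h' => hx ((hSt x).1 h')
      rw [Set.indicator_of_notMem hx', Set.indicator_of_notMem hx, mul_zero]
  have h5 : (1 - conj ((ψ (σ * t₀) : ℂ))) * ∫ x in S, conj ((ψ (σ * x) : ℂ)) * h x ∂μ = 0 := by
    rw [sub_mul, one_mul, ← key, sub_self]
  exact (mul_eq_zero.1 h5).resolve_left (sub_ne_zero.2 (Ne.symm hne))

/-- **THE FAR BALL INTEGRATES TO ZERO**: for `g` with tail `C ν(·)⁻¹‖·‖^{−e}` off `𝔭^n`, `ν` of conductor letter `c_ν`, `ψ` of conductor exponent `c_ψ`, `σ ∉ 𝔭^{c_ψ − j}`,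
`M ≥ max(−n, −j, c_ν − j − 1)` and a centre `c ∉ 𝔭^{−M}`: `∫_{c + 𝔭^{−M}} conj ψ(σx) · g(x) dμ = 0` — at EVERY exponent `e`, no integrability needed.
[cite: Tate1950, §2.5] [cite: CasselmanShalika1980, §2] -/
theorem setIntegral_farBall_twisted_eq_zero (g : F → ℂ) (ν : Fˣ →* ℂˣ) (cν : ℤ)
    (hνc : ∀ u : Fˣ, normAbs F (u : F) = 1 → (u : F) - 1 ∈ primePowBall F cν → ν u = 1) (C e : ℂ) {n : ℤ}
    (htail : ∀ u : Fˣ, (u : F) ∉ primePowBall F n → g u = C * (((ν u)⁻¹ : ℂˣ) : ℂ) * ((normAbs F (u : F) : ℝ) : ℂ) ^ (-e))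
    {ψ : AddChar F Circle} {cψ : ℤ} (hcψ : ψ.HasConductorExp cψ) {σ : F} {j : ℤ} (hσ : σ ∉ primePowBall F (cψ - j))
    {M : ℤ} (hnM : -n ≤ M) (hjM : -M ≤ j) (hcM : cν - j - 1 ≤ M) {c : F} (hc : c ∉ primePowBall F (-M)) :
    ∫ x in {x : F | x - c ∈ primePowBall F (-M)}, conj ((ψ (σ * x) : ℂ)) * g x ∂μ = 0 := by
  obtain ⟨t₀, ht₀, hψt₀⟩ := exists_mem_primePowBall_addChar_mul_ne_one hcψ hσ
  rw [mul_comm] at hψt₀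
  have hT : MeasurableSet {x : F | x - c ∈ primePowBall F (-M)} := (measurableSet_primePowBall (-M)).preimage (measurable_id.sub_const c)
  refine setIntegral_twisted_eq_zero_of_invariant μ ψ σ hT t₀ (fun x => ?_) g (fun x hx => ?_) hψt₀
  · -- invariance of the far ball under `+ t₀` (`t₀ ∈ 𝔭^j ⊆ 𝔭^{−M}`)
    simp only [Set.mem_setOf_eq]
    have ht₀' : t₀ ∈ primePowBall F (-M) := primePowBall_antitone hjM ht₀
    constructor
    · intro h
      have h' := add_mem_primePowBall h (neg_mem_primePowBall ht₀')
      rwa [show t₀ + x - c + -t₀ = x - c by ring] at h'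
    · intro h
      have h' := add_mem_primePowBall h ht₀'
      rwa [show x - c + t₀ = t₀ + x - c by ring] at h'
  · exact apply_add_eq_of_tail g ν cν hνc C e htail hnM hjM hcM ht₀ (not_mem_primePowBall_of_sub_mem hc hx)

end FarBall

end Summit.HodgeConjecture.HodgeConjecture.Cruxes.HLiu418.K2LiuTwistedFarBall

end
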